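import Summits.CriticalPhenomena.PercolationContinuityZ3.Theorems.PercNearOneGluingNoHeavyLowerTailAntitheticPieces
import Mathlib.Combinatorics.SetFamily.FourFunctions
import HarnessLib

/-!
# `NoHeavyLowerTail` (stmt-CriticalPhenomena-4575) — antithetic cluster pairs: Harris on a LATTICE FAMILY, pieces as
# Boolean subalgebras ("tied cubes"), and the partition principle (prim-hp-2 gen 36, MEMO-gen36 §1)

Support file (`--supports stmt-CriticalPhenomena-4575`, hull-port prover `prim-hp-2`, gen 36).  No definitions of record, no named
facts, no sorries; standard axioms.

Setting: as in the gen-31…35 files (`…AntitheticHarris`, `…AntitheticPieces`, `…AntitheticClassCover`, `…AntitheticParallel`,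
`…AntitheticSealing`).  A PIECE (gen 32) is a cube of colourings `S ↦ N ∆ ⋃_{i ∈ S} g i` (blocks `g i`, top `N`) along which the red
cluster is antitone; THEOREM I (gen 35, cones) ties zone blocks that share an edge.  This file removes the bookkeeping of ties and
merged blocks: the members of a tied piece are exactly `{N ∆ A : A ∈ 𝒜}` for a family `𝒜` of edge sets closed under `∩`, `∪` and
complement (the Boolean subalgebra of edge sets that split no block), and Harris' inequality holds on ANY finite `⊓/⊔`-closed family of
a distributive lattice (Mathlib's four functions theorem with the indicator weight of the family).  So:

* `Antithetic.harris_latticeFamily`, `Antithetic.harris_latticeFamily_centred` — Harris–FKG for the counting weight on a finite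
  `⊓/⊔`-closed family `𝒜` of a distributive lattice, for functions monotone ON `𝒜` (nonnegative, resp. of zero sum on `𝒜`).
* `Antithetic.piece_latticeFamily` — the piece lemma on such a family closed under complement: `Φ` antitone on `𝒜`, `F, G`
  monotone ⇒ `0 ≤ Σ_{A ∈ 𝒜} (F(Φ A) − F(Φ Aᶜ))(G(Φ A) − G(Φ Aᶜ))`.
* `Antithetic.blockAlgebra_*` — the family `{A | ∀ i ∈ I, blk i ⊆ A ∨ Disjoint (blk i) A}` of sets splitting no block is closed under
  `∩`, `∪`, `ᶜ` and contains `∅`.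
* `Antithetic.piece_algebra_sum_nonneg` — cluster form: if the red edge cluster of `N ∆ A` is antitone in `A ∈ 𝒜` then the antithetic
  sum over the colourings `{N ∆ A : A ∈ 𝒜}` is nonnegative.
* `Antithetic.sum_nonneg_of_parts` — the PARTITION PRINCIPLE: if every `T ∈ D` lies in a part `P T ⊆ D`, parts are constant on
  themselves (`M ∈ P T ⇒ P M = P T`) and every part has a nonnegative sum, then the sum over `D` is nonnegative.
[cite: VandenbergHaggstromKahn2005, §1 p. 6 ("Harris' inequality")]
-/

noncomputable section

namespace Summit.CriticalPhenomena.PercolationContinuityZ3.Theorems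

open scoped Classical symmDiff
open Literature.Probability.Percolation

namespace Antithetic

section LatticeFamily

variable {α : Type*} [DistribLattice α] [Fintype α]

/-- **Harris–FKG on a `⊓/⊔`-closed family.**  `𝒜` a finite family in a distributive lattice closed under `⊓` and `⊔`; `f, g ≥ 0`
monotone on `𝒜`.  Then `(Σ_𝒜 f)(Σ_𝒜 g) ≤ #𝒜 · Σ_𝒜 f g` (four functions theorem with the indicator weight of `𝒜`).
[cite: VandenbergHaggstromKahn2005, §1 p. 6 ("Harris' inequality"); Mathlib `four_functions_theorem_univ`] -/
theorem harris_latticeFamily (𝒜 : Finset α) (hinf : ∀ a ∈ 𝒜, ∀ b ∈ 𝒜, a ⊓ b ∈ 𝒜)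
    (hsup : ∀ a ∈ 𝒜, ∀ b ∈ 𝒜, a ⊔ b ∈ 𝒜) {f g : α → ℝ} (hf0 : ∀ a, 0 ≤ f a) (hg0 : ∀ a, 0 ≤ g a)
    (hf : ∀ a ∈ 𝒜, ∀ b ∈ 𝒜, a ≤ b → f a ≤ f b) (hg : ∀ a ∈ 𝒜, ∀ b ∈ 𝒜, a ≤ b → g a ≤ g b) :
    (∑ a ∈ 𝒜, f a) * ∑ a ∈ 𝒜, g a ≤ (𝒜.card : ℝ) * ∑ a ∈ 𝒜, f a * g a := by
  set μ : α → ℝ := fun a => if a ∈ 𝒜 then 1 else 0 with hμ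
  have hμ0 : ∀ a, 0 ≤ μ a := fun a => by
    simp only [hμ]; split_ifs <;> norm_num
  have e : ∀ h : α → ℝ, ∑ a, μ a * h a = ∑ a ∈ 𝒜, h a := by
    intro h
    have : ∀ a, μ a * h a = if a ∈ 𝒜 then h a else 0 := fun a => by
      simp only [hμ]; split_ifs <;> simp
    simp_rw [this]
    rw [Finset.sum_ite_mem, Finset.univ_inter]
  have e1 : ∑ a, μ a = (𝒜.card : ℝ) := by
    have := e fun _ => 1
    simp only [mul_one, Finset.sum_const, nsmul_eq_mul] at this
    exact this
  have h := four_functions_theorem_univ (fun a => μ a * f a) (fun a => μ a * g a) μ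
    (fun a => μ a * (f a * g a)) (fun a => mul_nonneg (hμ0 a) (hf0 a)) (fun a => mul_nonneg (hμ0 a) (hg0 a)) hμ0
    (fun a => mul_nonneg (hμ0 a) (mul_nonneg (hf0 a) (hg0 a))) ?_
  · have e2 := e f
    have e3 := e g
    have e4 := e fun a => f a * g a
    rw [e2, e3, e4, e1] at h
    exact h
  · intro a b
    by_cases hab : a ∈ 𝒜 ∧ b ∈ 𝒜
    · obtain ⟨ha, hb⟩ := hab
      have h1 : μ a = 1 := if_pos ha
      have h2 : μ b = 1 := if_pos hb
      have h3 : μ (a ⊓ b) = 1 := if_pos (hinf a ha b hb)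
      have h4 : μ (a ⊔ b) = 1 := if_pos (hsup a ha b hb)
      rw [h1, h2, h3, h4, one_mul, one_mul, one_mul, one_mul]
      exact mul_le_mul (hf a ha _ (hsup a ha b hb) le_sup_left) (hg b hb _ (hsup a ha b hb) le_sup_right) (hg0 _)
        (hf0 _)
    · have h0 : μ a * f a * (μ b * g b) = 0 := by
        rcases not_and_or.1 hab with ha | hb
        · have : μ a = 0 := if_neg ha
          rw [this]; ring
        · have : μ b = 0 := if_neg hb
          rw [this]; ring
      rw [h0]
      exact mul_nonneg (hμ0 _) (mul_nonneg (hμ0 _) (mul_nonneg (hf0 _) (hg0 _)))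

/-- Centred Harris on a `⊓/⊔`-closed family with a least element: `u, v` monotone on `𝒜` (any sign) with `Σ_𝒜 u = Σ_𝒜 v = 0`
satisfy `0 ≤ Σ_𝒜 u v`. [folklore] -/
theorem harris_latticeFamily_centred (𝒜 : Finset α) (hinf : ∀ a ∈ 𝒜, ∀ b ∈ 𝒜, a ⊓ b ∈ 𝒜)
    (hsup : ∀ a ∈ 𝒜, ∀ b ∈ 𝒜, a ⊔ b ∈ 𝒜) {b₀ : α} (hb₀ : b₀ ∈ 𝒜) (hbot : ∀ a ∈ 𝒜, b₀ ≤ a) {u v : α → ℝ}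
    (hu : ∀ a ∈ 𝒜, ∀ b ∈ 𝒜, a ≤ b → u a ≤ u b) (hv : ∀ a ∈ 𝒜, ∀ b ∈ 𝒜, a ≤ b → v a ≤ v b)
    (hu0 : ∑ a ∈ 𝒜, u a = 0) (hv0 : ∑ a ∈ 𝒜, v a = 0) : 0 ≤ ∑ a ∈ 𝒜, u a * v a := by
  set cu := u b₀ with hcu
  set cv := v b₀ with hcv
  set u' : α → ℝ := fun a => if a ∈ 𝒜 then u a - cu else 0 with hu'
  set v' : α → ℝ := fun a => if a ∈ 𝒜 then v a - cv else 0 with hv'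
  have hu'0 : ∀ a, 0 ≤ u' a := fun a => by
    simp only [hu']; split_ifs with h
    · exact sub_nonneg.2 (hu _ hb₀ _ h (hbot a h))
    · exact le_rfl
  have hv'0 : ∀ a, 0 ≤ v' a := fun a => by
    simp only [hv']; split_ifs with h
    · exact sub_nonneg.2 (hv _ hb₀ _ h (hbot a h))
    · exact le_rfl
  have hu'm : ∀ a ∈ 𝒜, ∀ b ∈ 𝒜, a ≤ b → u' a ≤ u' b := fun a ha b hb hab => by
    simp only [hu', if_pos ha, if_pos hb]; exact sub_le_sub_right (hu a ha b hb hab) _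
  have hv'm : ∀ a ∈ 𝒜, ∀ b ∈ 𝒜, a ≤ b → v' a ≤ v' b := fun a ha b hb hab => by
    simp only [hv', if_pos ha, if_pos hb]; exact sub_le_sub_right (hv a ha b hb hab) _
  have h := harris_latticeFamily 𝒜 hinf hsup hu'0 hv'0 hu'm hv'm
  set N : ℝ := (𝒜.card : ℝ) with hN
  have eu : ∑ a ∈ 𝒜, u' a = -(N * cu) := by
    rw [Finset.sum_congr rfl fun a (ha : a ∈ 𝒜) => show u' a = u a - cu from if_pos ha, Finset.sum_sub_distrib, hu0,
      Finset.sum_const, nsmul_eq_mul]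
    ring
  have ev : ∑ a ∈ 𝒜, v' a = -(N * cv) := by
    rw [Finset.sum_congr rfl fun a (ha : a ∈ 𝒜) => show v' a = v a - cv from if_pos ha, Finset.sum_sub_distrib, hv0,
      Finset.sum_const, nsmul_eq_mul]
    ring
  have euv : ∑ a ∈ 𝒜, u' a * v' a = ∑ a ∈ 𝒜, u a * v a + N * (cu * cv) := by
    rw [Finset.sum_congr rfl fun a (ha : a ∈ 𝒜) =>
      show u' a * v' a = u a * v a - cv * u a - cu * v a + cu * cv by
        rw [show u' a = u a - cu from if_pos ha, show v' a = v a - cv from if_pos ha]; ring]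
    rw [Finset.sum_add_distrib, Finset.sum_sub_distrib, Finset.sum_sub_distrib, ← Finset.mul_sum, ← Finset.mul_sum, hu0,
      hv0, Finset.sum_const, nsmul_eq_mul]
    ring
  rw [eu, ev, euv] at h
  have hNpos : (0 : ℝ) < N := by
    rw [hN]; exact_mod_cast Finset.card_pos.2 ⟨b₀, hb₀⟩
  nlinarith

/-- **Piece lemma on a lattice family closed under complement** (α a Boolean algebra, e.g. `Set X`): `𝒜` closed under `⊓`, `⊔`,
`ᶜ` with `⊥ ∈ 𝒜`; `Φ` antitone on `𝒜`; `F, G` monotone.  Then `0 ≤ Σ_{A ∈ 𝒜} (F(Φ A) − F(Φ Aᶜ))(G(Φ A) − G(Φ Aᶜ))`.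
(`u A := F(Φ Aᶜ) − F(Φ A)` is monotone on `𝒜` with zero sum by the involution `A ↦ Aᶜ` of `𝒜`.) [folklore] -/
theorem piece_latticeFamily {γ : Type*} [BooleanAlgebra γ] [Fintype γ] {τ : Type*} [Preorder τ] (𝒜 : Finset γ)
    (hinf : ∀ a ∈ 𝒜, ∀ b ∈ 𝒜, a ⊓ b ∈ 𝒜) (hsup : ∀ a ∈ 𝒜, ∀ b ∈ 𝒜, a ⊔ b ∈ 𝒜) (hcompl : ∀ a ∈ 𝒜, aᶜ ∈ 𝒜)
    (hbot : ⊥ ∈ 𝒜) (Φ : γ → τ) (hΦ : ∀ a ∈ 𝒜, ∀ b ∈ 𝒜, a ≤ b → Φ b ≤ Φ a) {F G : τ → ℝ} (hF : Monotone F)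
    (hG : Monotone G) : 0 ≤ ∑ A ∈ 𝒜, (F (Φ A) - F (Φ Aᶜ)) * (G (Φ A) - G (Φ Aᶜ)) := by
  have hu : ∀ a ∈ 𝒜, ∀ b ∈ 𝒜, a ≤ b → F (Φ aᶜ) - F (Φ a) ≤ F (Φ bᶜ) - F (Φ b) := fun a ha b hb hab =>
    sub_le_sub (hF (hΦ _ (hcompl b hb) _ (hcompl a ha) (compl_le_compl hab))) (hF (hΦ a ha b hb hab))
  have hv : ∀ a ∈ 𝒜, ∀ b ∈ 𝒜, a ≤ b → G (Φ aᶜ) - G (Φ a) ≤ G (Φ bᶜ) - G (Φ b) := fun a ha b hb hab =>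
    sub_le_sub (hG (hΦ _ (hcompl b hb) _ (hcompl a ha) (compl_le_compl hab))) (hG (hΦ a ha b hb hab))
  have hsum : ∀ H : τ → ℝ, ∑ a ∈ 𝒜, (H (Φ aᶜ) - H (Φ a)) = 0 := by
    intro H
    rw [Finset.sum_sub_distrib, sub_eq_zero]
    exact Finset.sum_nbij' (fun a => aᶜ) (fun a => aᶜ) (fun a ha => hcompl a ha) (fun a ha => hcompl a ha)
      (fun a _ => compl_compl a) (fun a _ => compl_compl a) (fun a _ => rfl)
  have h := harris_latticeFamily_centred 𝒜 hinf hsup hbot (fun a _ => bot_le) hu hv (hsum F) (hsum G)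
  refine h.trans_eq (Finset.sum_congr rfl fun a _ => ?_)
  ring

end LatticeFamily

section BlockAlgebra

variable {X : Type*} {ι : Type*}

/-- The family of sets that split no block contains `∅`. [folklore] -/
theorem blockAlgebra_empty (I : Set ι) (blk : ι → Set X) :
    (∅ : Set X) ∈ {A : Set X | ∀ i ∈ I, blk i ⊆ A ∨ Disjoint (blk i) A} :=
  fun _ _ => Or.inr (Set.disjoint_empty _)

/-- The family of sets that split no block is closed under complement. [folklore] -/
theorem blockAlgebra_compl (I : Set ι) (blk : ι → Set X) {A : Set X}
    (hA : A ∈ {A : Set X | ∀ i ∈ I, blk i ⊆ A ∨ Disjoint (blk i) A}) :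
    Aᶜ ∈ {A : Set X | ∀ i ∈ I, blk i ⊆ A ∨ Disjoint (blk i) A} := by
  intro i hi
  rcases hA i hi with h | h
  · exact Or.inr (Set.disjoint_compl_right_iff_subset.2 h)
  · exact Or.inl (Set.subset_compl_iff_disjoint_right.2 h)

/-- The family of sets that split no block is closed under intersection. [folklore] -/
theorem blockAlgebra_inter (I : Set ι) (blk : ι → Set X) {A B : Set X}
    (hA : A ∈ {A : Set X | ∀ i ∈ I, blk i ⊆ A ∨ Disjoint (blk i) A})
    (hB : B ∈ {A : Set X | ∀ i ∈ I, blk i ⊆ A ∨ Disjoint (blk i) A}) :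
    A ∩ B ∈ {A : Set X | ∀ i ∈ I, blk i ⊆ A ∨ Disjoint (blk i) A} := by
  intro i hi
  rcases hA i hi with h | h
  · rcases hB i hi with h' | h'
    · exact Or.inl (Set.subset_inter h h')
    · exact Or.inr (h'.mono_right Set.inter_subset_right)
  · exact Or.inr (h.mono_right Set.inter_subset_left)

/-- The family of sets that split no block is closed under union. [folklore] -/
theorem blockAlgebra_union (I : Set ι) (blk : ι → Set X) {A B : Set X}
    (hA : A ∈ {A : Set X | ∀ i ∈ I, blk i ⊆ A ∨ Disjoint (blk i) A})
    (hB : B ∈ {A : Set X | ∀ i ∈ I, blk i ⊆ A ∨ Disjoint (blk i) A}) :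
    A ∪ B ∈ {A : Set X | ∀ i ∈ I, blk i ⊆ A ∨ Disjoint (blk i) A} := by
  intro i hi
  rcases hA i hi with h | h
  · exact Or.inl (h.trans Set.subset_union_left)
  · rcases hB i hi with h' | h'
    · exact Or.inl (h'.trans Set.subset_union_right)
    · exact Or.inr (Set.disjoint_union_right.2 ⟨h, h'⟩)

/-- Complement of a flipped colouring: `(N ∆ A)ᶜ = N ∆ Aᶜ`. [folklore] -/
theorem compl_symmDiff_eq (N A : Set X) : (N ∆ A)ᶜ = N ∆ Aᶜ := by
  ext x
  simp only [Set.mem_compl_iff, Set.mem_symmDiff]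
  tauto

end BlockAlgebra

section ClusterForm

variable {V : Type*} [Fintype V]

/-- **Piece lemma, tied-cube / subalgebra form** (MEMO-gen36 §1).  `𝒜` a finite family of edge sets closed under `∩`, `∪`, `ᶜ`
with `∅ ∈ 𝒜`, a top colouring `N`, and suppose the red edge cluster `C_s((N ∆ A) ∩ E)` is antitone in `A ∈ 𝒜`.  Then the
antithetic sum over the colourings `{N ∆ A : A ∈ 𝒜}` is nonnegative for monotone `F, G`.  (The gen-32 piece lemma is the case
`𝒜 = {⋃_{i∈S} g i}`; ties and merged blocks need no bookkeeping in this form.)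
[cite: VandenbergHaggstromKahn2005, §1 p. 6 ("Harris' inequality")] -/
theorem piece_algebra_sum_nonneg (E : Set (Sym2 V)) (s : V) (N : Set (Sym2 V)) (𝒜 : Finset (Set (Sym2 V)))
    (hinter : ∀ A ∈ 𝒜, ∀ B ∈ 𝒜, A ∩ B ∈ 𝒜) (hunion : ∀ A ∈ 𝒜, ∀ B ∈ 𝒜, A ∪ B ∈ 𝒜)
    (hcompl : ∀ A ∈ 𝒜, Aᶜ ∈ 𝒜) (hbot : (∅ : Set (Sym2 V)) ∈ 𝒜)
    (hanti : ∀ A ∈ 𝒜, ∀ B ∈ 𝒜, A ⊆ B → openEdgeCluster ((N ∆ B) ∩ E) s ⊆ openEdgeCluster ((N ∆ A) ∩ E) s)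
    {F G : Set (Sym2 V) → ℝ} (hF : Monotone F) (hG : Monotone G) :
    0 ≤ ∑ M ∈ 𝒜.image (N ∆ ·), (F (openEdgeCluster (M ∩ E) s) - F (openEdgeCluster (Mᶜ ∩ E) s)) *
      (G (openEdgeCluster (M ∩ E) s) - G (openEdgeCluster (Mᶜ ∩ E) s)) := by
  rw [Finset.sum_image fun A _ B _ h => symmDiff_right_injective N h]
  simp only [compl_symmDiff_eq]
  exact piece_latticeFamily 𝒜 hinter hunion hcompl hbot (fun A => openEdgeCluster ((N ∆ A) ∩ E) s) hanti hF hG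

end ClusterForm

section Parts

variable {κ : Type*}

/-- **Partition principle.**  `D` a finite set of configurations, `P T` the part of `T`: if `T ∈ P T ⊆ D` for `T ∈ D`, parts are
constant on themselves (`M ∈ P T ⇒ P M = P T`) and each part has nonnegative `Ψ`-sum, then `0 ≤ Σ_{T ∈ D} Ψ T` (the parts are the
fibres of `P` on `D`). [folklore] -/
theorem sum_nonneg_of_parts (D : Finset κ) (Ψ : κ → ℝ) (P : κ → Finset κ) (hmem : ∀ T ∈ D, T ∈ P T)
    (hsub : ∀ T ∈ D, P T ⊆ D) (hconst : ∀ T ∈ D, ∀ M ∈ P T, P M = P T) (hpos : ∀ T ∈ D, 0 ≤ ∑ M ∈ P T, Ψ M) :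
    0 ≤ ∑ T ∈ D, Ψ T := by
  rw [← Finset.sum_fiberwise_of_maps_to (s := D) (t := D.image P) (g := P) fun T hT => Finset.mem_image_of_mem P hT]
  refine Finset.sum_nonneg fun Q hQ => ?_
  obtain ⟨T, hT, rfl⟩ := Finset.mem_image.1 hQ
  have hfib : (D.filter fun M => P M = P T) = P T := by
    ext M
    simp only [Finset.mem_filter]
    constructor
    · rintro ⟨hM, hPM⟩
      rw [← hPM]
      exact hmem M hM
    · intro hM
      exact ⟨hsub T hT hM, hconst T hT M hM⟩
  rw [hfib]
  exact hpos T hT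

end Parts

end Antithetic

end Summit.CriticalPhenomena.PercolationContinuityZ3.Theorems
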